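import Literature.MathematicalPhysics.QuantumFieldTheory.Balaban1983to89.LatticeFieldCalculus

/-!
# `BalabanImbrieJaffe1984to88.BIJ85GaugeFunction5113` — T. Bałaban, J. Imbrie, A. Jaffe, *Renormalization of the Higgs model:
minimizers, propagators and the stability of mean field theory*, Commun. Math. Phys. **97** (1985) 299–329 [BalabanImbrieJaffe1985]:
Sect. 5.1, proof of Proposition 5.1.1, pp. 313–315 — the gauge function `λ = λ(A)` of (5.1.4)/(5.1.13) and its ingredients (the point
sequence (5.1.2)–(5.1.3), the contour functionals `(Q_jA)(Γ_{x_{j+1},x_j})`, `Q′(Q_jA)(Γ_{x_{j+1},·})`), TYPED WITH BODIES on the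
series' V1 lattice calculus, with the printed closed form PROVED from the recursive definition (file 1 of 2; linearity of `λ(A)`
and the identities (5.1.10)–(5.1.15) are proved in `…BIJ85Eq5113Proof`)

statement-level skeleton of published theorems with citation tags; proofs where landed; nothing here is a claim about the Yang–Mills mass gap

PDF held: `paper:balaban1985-cmp97-bij-higgs-minimizers` (journal page = PDF page + 298).  Pages 313–315 [PDF 15–17] were read as images
rendered (poppler ×2.4) from the held PDF (sha256 `edf5a2c9…6028e3`, byte-identical re-fetch of the Project Euclid open-access file):
`run/shared/lean/pub/lit-balaban/lit-balaban-p08/renders/bij85-p015.png … p017.png`.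

THE PRINTED TEXT (pp. 313–315, verbatim where quoted below).  Prop. 5.1.1: *"H_{k,Ax}B − H_kB = ∂λ. (5.1.1) … λ(x) = −Σ_{j=0}^{k−1}
L^{j−k}[(Q_jH_kB)(Γ_{x_{j+1},x_j}) − Σ_{x′∈B(x_{j+1})}(L^{−d}Q_jH_kB)(Γ_{x_{j+1},x′})]. (5.1.4) Here we use (Q_jH_kB)(Γ) = Σ_{b∈Γ}(Q_jH_kB)(b),
with no factor of the lattice spacing for Γ."*  Its proof (pp. 314–315) inserts `1 = Z_k^{−1}∫dλ δ(Q′_kλ)𝒢(∂*A − Δλ)` into (5.1.5), makes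
the gauge transformation `A → A + ∂λ` ((5.1.8)–(5.1.9)), and then *"we solve the system of linear equations for λ which result from the delta
functions δ(Q′_kλ) and δ_{k,Ax}(A + ∂λ)"* — the solution is (5.1.13), `λ(x) = λ(A, x)`, derived through (5.1.10)–(5.1.12); finally
(5.1.14)–(5.1.15): `λ(A)` is linear in `A`, so the mean of `A + ∂λ(A)` is `H_kB + ∂λ(H_kB)`.

CITATION HEADER (lean-in-tree rule).  Phase-2 file of the lit-balaban TYPED SKELETON (HOME `run/shared/lean/pub/lit-balaban/`), SKELETON row
**`C1.Eq5.1.5-5.1.15`** (reader r15 `ROWS-C1`; status `absent` before this file), seat p08 gen 2 (unit `lit-balaban-p08-g2`), fold-owner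
suggestion S2 of r15 (HOME/INBOX 2026-08-21T02:08:57Z).  WHAT IS REPRODUCED HERE, over the carriers OF RECORD of
`…Balaban1983to89.LatticeFieldCalculus` (tori `Setup.Site P j`, `SiteField`/`VecField`, `∂` = `grad c` with the lattice factor `c` an explicit
real parameter — `c = η⁻¹ = L^k` in print —, `Q′` = `siteAvg`, `Q` = `bondAvg`, `Q′_k` = `siteAvgIter k`, `Q_k` = `bondAvgIter k`, the staircase
contours `Γ_{y,x}` = `stairSum`, CENTRED blocks `Site.blockSite`/`blockOf`/`emb`, DIVERGENCE F3 of `pub-balaban` inherited; this file imports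
nothing else):
* §0 — linearity plumbing for `∂`, `Q′`, `Q′_k` (elementary; cited to the displays that define the operators);
* §1 — **(5.1.2)–(5.1.3)** the point sequence `x_j = blk j x` (iterated `blockOf`) and the read-out `pull k h = h(x_k)` (`Q′_k` undoes it:
  `siteAvgIter_pull`); the contour functional `contour f z = f(Γ_{z₊,z})` and its block mean `blockMean f = Q′(f(Γ_{y,·}))` (= the printed block
  sum, `blockMean_eq_blockSum`); the bracket `fluct f = contour f − blockMean f ∘ blockOf` of (5.1.12)/(5.1.13) (block mean zero: `siteAvg_fluct`);
  **(5.1.13)** `lamOf c k A = λ(A)` DEFINED by recursion on `k`, with the printed closed form PROVED (`lamOf_apply`, `eq5113_printed`, and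
  `eq5113_unit` at `c = L^k`: weights `L^{j−k}`) — (5.1.4) is `lamOf` at `A = H_kB`.
NOT HERE (file 2 `…BIJ85Eq5113Proof`, which also imports `…BIJ85AxialPropagator411` for `deltaAx` = `δ_{k,Ax}` and `…B5Eq120IterProof` for
`Q_j∂ = ∂Q′_j`): linearity of `λ(A)`, (5.1.10), (5.1.11), (5.1.12), the telescoping, (5.1.13) as the UNIQUE solution of the linear system
(+ existence), (5.1.14)–(5.1.15).  NOT REPRODUCED ANYWHERE (the instance's): the δ-function Faddeev–Popov manipulation (5.1.5)–(5.1.9)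
identifying the axial-gauge mean `H_{k,Ax}B` of (5.1.5) with `∫(A + ∂λ(A))dμ_Landau`; the minimizers `H_{k,Ax}`, `H_k` themselves stay on
`…BIJ85Sect4Statements.GaugeRG` (whose `lam514`/`Prop511` are the abstract forms of `lamOf`/(5.1.1)).  No new Prop-valued fact is introduced.
-/

namespace Literature.MathematicalPhysics.QuantumFieldTheory.BalabanImbrieJaffe1984to88.BIJ85GaugeFunction5113

open Literature.MathematicalPhysics.QuantumFieldTheory.Balaban1983to89
open LatticeFieldCalculus

/-! ## §0  Linearity plumbing for `∂`, `Q'`, `Q'_k`, `Q_k` (the operators of (5.1.10)–(5.1.13) are linear) -/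

section Plumbing

variable {P : Params} {j : ℕ} {V : Type*} [AddCommGroup V] [Module ℝ V]

/-- `∂` is additive in the gauge function ([Balaban1984PropagatorsI] (1.4): `A^λ = A − ∂λ` is linear in `λ`).
[cite: Balaban1984PropagatorsI, (1.4) p.18] -/
theorem grad_add (c : ℝ) (f g : SiteField P j V) : grad c (f + g) = grad c f + grad c g := by
  funext b; simp only [grad, Pi.add_apply]; module

/-- `∂` commutes with subtraction of gauge functions. [cite: Balaban1984PropagatorsI, (1.4) p.18] -/
theorem grad_sub (c : ℝ) (f g : SiteField P j V) : grad c (f - g) = grad c f - grad c g := by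
  funext b; simp only [grad, Pi.sub_apply]; module

/-- `∂` is odd in the gauge function. [cite: Balaban1984PropagatorsI, (1.4) p.18] -/
theorem grad_neg (c : ℝ) (f : SiteField P j V) : grad c (-f) = -grad c f := by
  funext b; simp only [grad, Pi.neg_apply]; module

/-- `∂` is homogeneous in the gauge function. [cite: Balaban1984PropagatorsI, (1.4) p.18] -/
theorem grad_smul (c a : ℝ) (f : SiteField P j V) : grad c (a • f) = a • grad c f := by
  funext b; simp only [grad, Pi.smul_apply]; module

/-- Rescaling the lattice factor of `∂`: `∂^{(a·c)}f = a·∂^{(c)}f`. [cite: Balaban1984PropagatorsI, (1.4) p.18] -/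
theorem grad_mul (a c : ℝ) (f : SiteField P j V) : grad (a * c) f = a • grad c f := by
  funext b; simp only [grad, Pi.smul_apply]; module

/-- `∂0 = 0`. [cite: Balaban1984PropagatorsI, (1.4) p.18] -/
theorem grad_zero (c : ℝ) : grad c (0 : SiteField P j V) = 0 := by
  funext b; simp [grad]

/-- `Q'` is additive ([Balaban1984PropagatorsI] (1.13): the site block average is linear). [cite: Balaban1984PropagatorsI, (1.13) p.19] -/
theorem siteAvg_add (f g : SiteField P j V) : siteAvg (f + g) = siteAvg f + siteAvg g := by
  funext y; simp only [siteAvg, Pi.add_apply, Finset.sum_add_distrib, smul_add]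

/-- `Q'` commutes with subtraction. [cite: Balaban1984PropagatorsI, (1.13) p.19] -/
theorem siteAvg_sub (f g : SiteField P j V) : siteAvg (f - g) = siteAvg f - siteAvg g := by
  funext y; simp only [siteAvg, Pi.sub_apply, Finset.sum_sub_distrib, smul_sub]

/-- `Q'` is homogeneous. [cite: Balaban1984PropagatorsI, (1.13) p.19] -/
theorem siteAvg_smul (a : ℝ) (f : SiteField P j V) : siteAvg (a • f) = a • siteAvg f := by
  funext y; simp only [siteAvg, Pi.smul_apply, ← Finset.smul_sum, smul_comm a]

/-- `Q'` only sees the block: two site functions that agree on `B(y)` have the same average at `y`.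
[cite: Balaban1984PropagatorsI, (1.13) p.19] -/
theorem siteAvg_congr_block {f g : SiteField P j V} (y : Site P (j + 1))
    (h : ∀ r : Fin P.d → Fin P.L, f (Site.blockSite y r) = g (Site.blockSite y r)) : siteAvg f y = siteAvg g y := by
  simp only [siteAvg, h]

/-- `Q'` REPRODUCES BLOCK-CONSTANT FUNCTIONS: averaging a coarse site function pulled back along the block map gives it
back, `Q'(h ∘ blockOf) = h` (standing range). [cite: Balaban1984PropagatorsI, (1.15) p.19] -/
theorem siteAvg_comp_blockOf (hj : j + 1 ≤ P.m + P.K) (h : SiteField P (j + 1) V) :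
    siteAvg (fun x => h (blockOf x)) = h := by
  funext y
  simp only [siteAvg, Site.blockOf_blockSite hj]
  rw [Finset.sum_const, Finset.card_univ, Fintype.card_fun, Fintype.card_fin, Fintype.card_fin,
    ← Nat.cast_smul_eq_nsmul ℝ, smul_smul]
  have hL : ((P.L : ℝ) ^ P.d) ≠ 0 := pow_ne_zero _ (Nat.cast_ne_zero.mpr P.L_pos.ne')
  rw [Nat.cast_pow, inv_mul_cancel₀ hL, one_smul]

/-- Every fine site is a `blockSite` of its own block (the offset parametrisation of `B(y)` is onto; standing range).
[cite: Balaban1987RG1, (0.3) p.252] -/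
theorem exists_blockSite_eq (hj : j + 1 ≤ P.m + P.K) (z : Site P j) :
    ∃ r : Fin P.d → Fin P.L, Site.blockSite (blockOf z) r = z :=
  ⟨Site.blockEquiv hj (blockOf z) ⟨z, rfl⟩,
    congrArg Subtype.val ((Site.blockEquiv hj (blockOf z)).symm_apply_apply ⟨z, rfl⟩)⟩

end Plumbing

section PlumbingIter

variable {P : Params} {V : Type*} [AddCommGroup V] [Module ℝ V]

/-- `Q'_k` is additive. [cite: Balaban1984PropagatorsI, (1.20) p.20] -/
theorem siteAvgIter_add : ∀ (k : ℕ) (f g : SiteField P 0 V), siteAvgIter k (f + g) = siteAvgIter k f + siteAvgIter k g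
  | 0, _, _ => rfl
  | k + 1, f, g => by
    show siteAvg (siteAvgIter k (f + g)) = siteAvg (siteAvgIter k f) + siteAvg (siteAvgIter k g)
    rw [siteAvgIter_add k, siteAvg_add]

/-- `Q'_k` commutes with subtraction. [cite: Balaban1984PropagatorsI, (1.20) p.20] -/
theorem siteAvgIter_sub : ∀ (k : ℕ) (f g : SiteField P 0 V), siteAvgIter k (f - g) = siteAvgIter k f - siteAvgIter k g
  | 0, _, _ => rfl
  | k + 1, f, g => by
    show siteAvg (siteAvgIter k (f - g)) = siteAvg (siteAvgIter k f) - siteAvg (siteAvgIter k g)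
    rw [siteAvgIter_sub k, siteAvg_sub]

/-- `Q'_k` is homogeneous. [cite: Balaban1984PropagatorsI, (1.20) p.20] -/
theorem siteAvgIter_smul : ∀ (k : ℕ) (a : ℝ) (f : SiteField P 0 V), siteAvgIter k (a • f) = a • siteAvgIter k f
  | 0, _, _ => rfl
  | k + 1, a, f => by
    show siteAvg (siteAvgIter k (a • f)) = a • siteAvg (siteAvgIter k f)
    rw [siteAvgIter_smul k, siteAvg_smul]

end PlumbingIter

/-! ## §1  The objects of (5.1.2)–(5.1.4) and (5.1.13): the point sequence `x_j`, the contour functionals, `λ(A)` -/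

section Objects

variable {P : Params} {V : Type*} [AddCommGroup V] [Module ℝ V]

/-- **(5.1.2)–(5.1.3)** p. 313–314 [PDF 15–16], verbatim: *"we choose a sequence of points x₀, …, x_k, where x = x₀, y = x_k,
and where x ∈ B^j(x_j), x_j ∈ T^{(j)}_{L^jη}, (5.1.2) that is x_j ∈ B(x_{j+1}). (5.1.3)"* — `blk k x = x_k`, the `k`-fold block
map of `Setup` (`x_{j+1} = blockOf x_j`). [cite: BalabanImbrieJaffe1985, (5.1.2)–(5.1.3) p.313] -/
def blk : (k : ℕ) → Site P 0 → Site P k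
  | 0 => fun x => x
  | k + 1 => fun x => blockOf (blk k x)

/-- A site function of `T^{(k)}` read at the point `x_k` of the sequence (5.1.2) of `x ∈ T^{(0)}`: `(pull k h)(x) = h(x_k)`
(defined by iterating the pull-back along `blockOf`). [cite: BalabanImbrieJaffe1985, (5.1.2)–(5.1.3) p.313] -/
def pull : (k : ℕ) → SiteField P k V → SiteField P 0 V
  | 0 => fun h => h
  | k + 1 => fun h => pull k (fun z => h (blockOf z))

omit [AddCommGroup V] [Module ℝ V] in
/-- `(pull k h)(x) = h(x_k)`. [cite: BalabanImbrieJaffe1985, (5.1.2)–(5.1.3) p.313] -/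
theorem pull_apply : ∀ (k : ℕ) (h : SiteField P k V) (x : Site P 0), pull k h x = h (blk k x)
  | 0, _, _ => rfl
  | k + 1, h, x => by
    show pull k (fun z => h (blockOf z)) x = h (blockOf (blk k x))
    rw [pull_apply k]

omit [AddCommGroup V] [Module ℝ V] in
/-- `pull (k+1) h = pull k (h ∘ blockOf)`. [cite: BalabanImbrieJaffe1985, (5.1.2)–(5.1.3) p.313] -/
theorem pull_succ (k : ℕ) (h : SiteField P (k + 1) V) : pull (k + 1) h = pull k (fun z => h (blockOf z)) := rfl

omit [Module ℝ V] in
/-- `pull k` is additive. [cite: BalabanImbrieJaffe1985, (5.1.13) p.315] -/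
theorem pull_add : ∀ (k : ℕ) (f g : SiteField P k V), pull k (f + g) = pull k f + pull k g
  | 0, _, _ => rfl
  | k + 1, f, g => by
    show pull k (fun z => (f + g) (blockOf z)) = pull k (fun z => f (blockOf z)) + pull k (fun z => g (blockOf z))
    rw [← pull_add k]; rfl

omit [Module ℝ V] in
/-- `pull k` commutes with subtraction. [cite: BalabanImbrieJaffe1985, (5.1.13) p.315] -/
theorem pull_sub : ∀ (k : ℕ) (f g : SiteField P k V), pull k (f - g) = pull k f - pull k g
  | 0, _, _ => rfl
  | k + 1, f, g => by
    show pull k (fun z => (f - g) (blockOf z)) = pull k (fun z => f (blockOf z)) - pull k (fun z => g (blockOf z))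
    rw [← pull_sub k]; rfl

/-- `pull k` is homogeneous. [cite: BalabanImbrieJaffe1985, (5.1.13) p.315] -/
theorem pull_smul : ∀ (k : ℕ) (a : ℝ) (f : SiteField P k V), pull k (a • f) = a • pull k f
  | 0, _, _ => rfl
  | k + 1, a, f => by
    show pull k (fun z => (a • f) (blockOf z)) = a • pull k (fun z => f (blockOf z))
    rw [← pull_smul k]; rfl

omit [Module ℝ V] in
/-- `pull k 0 = 0`. [cite: BalabanImbrieJaffe1985, (5.1.13) p.315] -/
theorem pull_zero : ∀ k : ℕ, pull k (0 : SiteField P k V) = 0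
  | 0 => rfl
  | k + 1 => by show pull k (fun _ => (0 : V)) = 0; exact pull_zero k

/-- `Q′_k` undoes `pull k`: a function of `x_k` averages back to itself, `Q′_k(h(x_k)) = h` (standing range).
[cite: Balaban1984PropagatorsI, (1.20) p.20] -/
theorem siteAvgIter_pull : ∀ (k : ℕ), k ≤ P.m + P.K → ∀ h : SiteField P k V, siteAvgIter k (pull k h) = h
  | 0, _, _ => rfl
  | k + 1, hk, h => by
    show siteAvg (siteAvgIter k (pull k (fun z => h (blockOf z)))) = h
    rw [siteAvgIter_pull k (by omega)]
    exact siteAvg_comp_blockOf hk h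

omit [AddCommGroup V] [Module ℝ V] in
/-- A function of `x_k` is a function of `x_{j+1}` for `j + 1 ≤ k` (the point sequence (5.1.2) is nested).
[cite: BalabanImbrieJaffe1985, (5.1.2)–(5.1.3) p.313] -/
theorem pull_factor (j : ℕ) : ∀ (k : ℕ), j + 1 ≤ k → ∀ h : SiteField P k V,
    ∃ h' : SiteField P (j + 1) V, pull k h = pull (j + 1) h' := by
  intro k hk
  induction k, hk using Nat.le_induction with
  | base => exact fun h => ⟨h, rfl⟩
  | succ k _ ih =>
    intro h
    obtain ⟨h', e⟩ := ih (fun z => h (blockOf z))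
    exact ⟨h', e⟩

variable {j : ℕ}

/-- The CONTOUR FUNCTIONAL of (5.1.4)/(5.1.10): for a bond field `f` of `T^{(j)}`, `(contour f)(z) = f(Γ_{z₊,z})`, the sum of `f`
along the staircase contour from the block centre `z₊ = blockOf z ∈ T^{(j+1)} ⊂ T^{(j)}` (embedded by `Setup.emb`) to `z ∈ B(z₊)`
(*"Here we use (Q_jH_kB)(Γ) = Σ_{b∈Γ}(Q_jH_kB)(b), with no factor of the lattice spacing for Γ"*, p. 314).
[cite: BalabanImbrieJaffe1985, (5.1.4) p.314] -/
def contour (f : VecField P j V) : SiteField P j V := fun z => stairSum f (emb (blockOf z)) z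

/-- The BLOCK MEAN of the contour functional, `Q'(f(Γ_{y,·}))(y) = Σ_{x′∈B(y)} L^{−d} f(Γ_{y,x′})` (the second term of the bracket
of (5.1.4)/(5.1.12)/(5.1.13); *"the final Q′ acts on '·'"*, p. 315). [cite: BalabanImbrieJaffe1985, (5.1.11) p.315] -/
noncomputable def blockMean (f : VecField P j V) : SiteField P (j + 1) V := siteAvg (contour f)

/-- The BRACKET of (5.1.12)/(5.1.13): `(fluct f)(z) = f(Γ_{z₊,z}) − Q'(f(Γ_{z₊,·}))`, the contour functional minus its block mean.
[cite: BalabanImbrieJaffe1985, (5.1.12) p.315] -/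
noncomputable def fluct (f : VecField P j V) : SiteField P j V := fun z => contour f z - blockMean f (blockOf z)

/-- In the standing range the block mean IS the printed block sum `Σ_{x′∈B(y)} L^{−d} f(Γ_{y,x′})` over `B(y) = Setup.block y`.
[cite: BalabanImbrieJaffe1985, (5.1.4) p.314] -/
theorem blockMean_eq_blockSum (hj : j + 1 ≤ P.m + P.K) (f : VecField P j V) (y : Site P (j + 1)) :
    blockMean f y = (((P.L : ℝ) ^ P.d)⁻¹) • ∑ x' ∈ block y, stairSum f (emb y) x' := by
  unfold blockMean
  rw [siteAvg_eq_blockSum hj]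
  congr 1
  refine Finset.sum_congr rfl fun x hx => ?_
  have hx' : blockOf x = y := (Finset.mem_filter.mp hx).2
  simp only [contour, hx']

/-- The bracket has BLOCK MEAN ZERO: `Q'(fluct f) = 0` (standing range). [cite: BalabanImbrieJaffe1985, (5.1.12) p.315] -/
theorem siteAvg_fluct (hj : j + 1 ≤ P.m + P.K) (f : VecField P j V) : siteAvg (fluct f) = 0 := by
  have h : fluct f = contour f - fun z => blockMean f (blockOf z) := rfl
  rw [h, siteAvg_sub, siteAvg_comp_blockOf hj]
  exact sub_self _

/-- **(5.1.13)** p. 315 [PDF 17], the gauge function `λ = λ(A)` as a function of an arbitrary η-lattice bond field `A`, verbatim: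
*"λ(x) = λ(A, x) = −Σ_{j=0}^{k−1} L^{j−k}[(Q_jA)(Γ_{x_{j+1},x_j}) − Q′(Q_jA)(Γ_{x_{j+1},·})]. (5.1.13)"* — typed over the V1 lattice
calculus with the lattice factor `c` of `∂` as a parameter (`c = η⁻¹ = L^k` in print, so that the printed `L^{j−k} = L^jη` is `L^j/c`),
`Q_j = bondAvgIter j`, defined by recursion on `k` (the closed form is `lamOf_apply`); (5.1.4) is this function at `A = H_kB`.
[cite: BalabanImbrieJaffe1985, (5.1.13) p.315] -/
noncomputable def lamOf (c : ℝ) : (k : ℕ) → VecField P 0 V → SiteField P 0 V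
  | 0 => fun _ => 0
  | k + 1 => fun A => lamOf c k A - ((P.L : ℝ) ^ k / c) • pull k (fluct (bondAvgIter k A))

/-- The recursion step of `λ(A)`: `λ_{k+1}(A) = λ_k(A) − (L^k/c)·[(Q_kA)(Γ_{x_{k+1},x_k}) − Q′(Q_kA)(Γ_{x_{k+1},·})]`.
[cite: BalabanImbrieJaffe1985, (5.1.13) p.315] -/
theorem lamOf_succ (c : ℝ) (k : ℕ) (A : VecField P 0 V) :
    lamOf c (k + 1) A = lamOf c k A - ((P.L : ℝ) ^ k / c) • pull k (fluct (bondAvgIter k A)) := rfl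

/-- **(5.1.13) as printed** (closed form): `λ(A, x) = −Σ_{j=0}^{k−1} (L^j/c)·[(Q_jA)(Γ_{x_{j+1},x_j}) − Q′(Q_jA)(Γ_{x_{j+1},·})]` with
`x_j = blk j x`. [cite: BalabanImbrieJaffe1985, (5.1.13) p.315] -/
theorem lamOf_apply (c : ℝ) : ∀ (k : ℕ) (A : VecField P 0 V) (x : Site P 0),
    lamOf c k A x = -∑ j ∈ Finset.range k, ((P.L : ℝ) ^ j / c) • fluct (bondAvgIter j A) (blk j x)
  | 0, _, _ => by simp [lamOf]
  | k + 1, A, x => by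
    rw [lamOf_succ, Pi.sub_apply, Pi.smul_apply, pull_apply, lamOf_apply c k, Finset.sum_range_succ, neg_add, sub_eq_add_neg]

/-- **(5.1.13)**, every symbol unfolded (standing range `k ≤ m + K`): `λ(A, x) = −Σ_{j<k} (L^j/c)·[(Q_jA)(Γ_{x_{j+1},x_j}) −
Σ_{x′∈B(x_{j+1})} L^{−d}(Q_jA)(Γ_{x_{j+1},x′})]`, `x_j = blk j x`, `x_{j+1} = blockOf x_j`, `Γ` = `stairSum` from `emb x_{j+1}`.
[cite: BalabanImbrieJaffe1985, (5.1.13) p.315] -/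
theorem eq5113_printed {k : ℕ} (hk : k ≤ P.m + P.K) (c : ℝ) (A : VecField P 0 V) (x : Site P 0) :
    lamOf c k A x = -∑ j ∈ Finset.range k, ((P.L : ℝ) ^ j / c) •
      (stairSum (bondAvgIter j A) (emb (blockOf (blk j x))) (blk j x)
        - (((P.L : ℝ) ^ P.d)⁻¹) • ∑ x' ∈ block (blockOf (blk j x)), stairSum (bondAvgIter j A) (emb (blockOf (blk j x))) x') := by
  rw [lamOf_apply]
  congr 1
  refine Finset.sum_congr rfl fun j hj => ?_
  have hj' : j + 1 ≤ P.m + P.K := by have := Finset.mem_range.mp hj; omega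
  simp only [fluct, contour, blockMean_eq_blockSum hj']

/-- (5.1.13) at the PRINTED normalisation `c = η⁻¹ = L^k`: the weights are `L^j/L^k = L^{j−k}`.
[cite: BalabanImbrieJaffe1985, (5.1.13) p.315] -/
theorem eq5113_unit (k : ℕ) (A : VecField P 0 V) (x : Site P 0) :
    lamOf ((P.L : ℝ) ^ k) k A x = -∑ j ∈ Finset.range k, ((P.L : ℝ) ^ ((j : ℤ) - k)) • fluct (bondAvgIter j A) (blk j x) := by
  rw [lamOf_apply]
  congr 1
  refine Finset.sum_congr rfl fun j _ => ?_
  have hL : (P.L : ℝ) ≠ 0 := Nat.cast_ne_zero.mpr P.L_pos.ne'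
  rw [zpow_sub₀ hL, zpow_natCast, zpow_natCast]

end Objects

end Literature.MathematicalPhysics.QuantumFieldTheory.BalabanImbrieJaffe1984to88.BIJ85GaugeFunction5113
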